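import Summits.QuantumFields.YangMills.Theorems.OnsetSkewLawRPOnsetFloorCoarseCollarAtoms
import HarnessLib

/-!
# Cruxes `OnsetSkewLaw.RPOnsetFloor` (stmt-QuantumFields-23138) and `MarkovAtoms.OnsetFloor` (stmt-QuantumFields-22956), shared stub
# `stub_coarseCollarAtomRPFloor`: atoms hugging the mirror and UV atoms (part 1b of `OnsetSkewLawRPOnsetFloorCoarseCollar.lean`)

Two more atom lemmas for `RPOnsetFloorCoarseCollar.coarseCollar_of_crossFloor`, needed because the atoms of the REFLECTED companion
`B′_{v,s}` of the cross floor (temporal plaquettes read one layer lower) have centre-coordinate offsets of height `η₀/σ − s_I/2`,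
which is NEGATIVE for fine atoms low in the slab:

* `atom_dependsOn_of_valid` — an atom of a positive-time profile with a VALID orientation and offset height `y₀ ≥ −s/2` still
  lives in the RP cone `DependsOn · (siteHalfEdges 0)` (every weighted plaquette has base height `≥ 0`:
  `base_nonneg_of_weight_ne_zero_of_valid`, using `2·(o_q)₀ ∈ {0,1}`);
* `abs_rpSq_le_of_deficit` — UV QUIETNESS AT ARBITRARY OFFSETS: if every valid plaquette of orientation `q` has deficit
  `∫ (N − P) dμ ≤ D`, then the route's RP square `rpSq {q} s y` (text spelled out) of a `b`-atom of spacing `s ≥ s₀` is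
  `≤ ((⌈R₀/s₀⌉₊+1)⁴ M_b)² · 2 N D` for EVERY offset `y` (finite double sum over the two site boxes `atomSites`, each term bounded by
  `OnsetSkewLawGlue.abs_stateMomentStr_two_le`).  With `OnsetSkewLawGlue.integral_deficit_le` (weak-coupling plaquette floor in
  odd-torus limit states) this excludes UV atoms without any cell-offset hypothesis.

HONEST FRAMING: bookkeeping; no stub / crux / rung / summit is proved; the Yang–Mills mass gap is NOT proved.  Cell `ym-idea-1`,
width seat `ym-line-sfw-p2-w5` g16 (free hands), on planner ym-idea-11 g13's GO (cell STATUS 2026-08-29T04:23:44Z). [folklore]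
-/

set_option autoImplicit false

noncomputable section

open scoped BigOperators
open MeasureTheory ProbabilityTheory Filter Topology
open Literature.MathematicalPhysics.QuantumFieldTheory Literature.MathematicalPhysics.QuantumLattice
open Literature.Probability.LatticeModels (Site)
open Summit.QuantumFields.YangMills.Cruxes.OSLegsFromFemtoAndGap.DlrCollarTransfer (plane continuous_plane)
open Summit.QuantumFields.GaugeBoot (siteHalfEdges)
open Summit.QuantumFields.YangMills.Theorems.InfiniteVolume (stateMomentStr)
open Summit.QuantumFields.YangMills.Theorems.InfVolRP (centreOffset two_mul_centreOffset_zero centreOffset_time dependsOn_plane)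
open Summit.QuantumFields.YangMills.Theorems.MarkovAtomsOnsetFloorMarkovTail (mirrorOffset mirror_weight atomSites
  weight_eq_zero_of_not_mem)
open Summit.QuantumFields.YangMills.Theorems.OnsetSkewLawGlue (abs_stateMomentStr_two_le)

namespace Summit.QuantumFields.YangMills.Theorems.RPOnsetFloorCoarseCollar

variable {G : Type} [Group G] [TopologicalSpace G] [IsTopologicalGroup G] [CompactSpace G]
  [MeasurableSpace G] [BorelSpace G]

omit [IsTopologicalGroup G] [CompactSpace G] [MeasurableSpace G] [BorelSpace G] in
/-- For a positive-time profile, a VALID orientation and an offset of height `≥ −s/2`, every weighted plaquette has base height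
`≥ 0` (temporal plaquettes have centre height `x₀ + 1/2`, spatial ones `x₀`). [folklore] -/
theorem base_nonneg_of_weight_ne_zero_of_valid {b : EuclideanSpace ℝ (Fin 4) → ℝ}
    (hbpos : tsupport b ⊆ {u : EuclideanSpace ℝ (Fin 4) | 0 < u 0}) {s : ℝ} (hs : 0 < s) {q : Fin 4 × Fin 4}
    (hq : q.1 < q.2) {y : EuclideanSpace ℝ (Fin 4)} (hy : -(s / 2) ≤ y 0) {x : Fin 4 → ℤ}
    (hx : b (s • (siteToE x + centreOffset q) - y) ≠ 0) : 0 ≤ x 0 := by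
  have hmem : s • (siteToE x + centreOffset q) - y ∈ {u : EuclideanSpace ℝ (Fin 4) | 0 < u 0} :=
    hbpos (subset_tsupport _ hx)
  simp only [Set.mem_setOf_eq, PiLp.sub_apply, PiLp.smul_apply, PiLp.add_apply, siteToE_apply, smul_eq_mul] at hmem
  have ho : centreOffset q 0 ≤ 1 / 2 := by
    have h2 := two_mul_centreOffset_zero hq
    split_ifs at h2 <;> linarith
  by_contra hneg
  push Not at hneg
  have h1 : (x 0 : ℝ) ≤ -1 := by exact_mod_cast (show x 0 ≤ -1 by omega)
  have h2 : (x 0 : ℝ) + centreOffset q 0 ≤ -(1 / 2) := by linarith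
  have h3 : s * ((x 0 : ℝ) + centreOffset q 0) ≤ s * (-(1 / 2)) := mul_le_mul_of_nonneg_left h2 hs.le
  linarith

omit [IsTopologicalGroup G] [CompactSpace G] [BorelSpace G] in
/-- **Atoms with valid orientation and offset height `≥ −s/2` live in the positive-time cone** `DependsOn · (siteHalfEdges 0)`
(this covers the atoms of the reflected companion `B′`, whose offsets may dip below the mirror). [folklore] -/
theorem atom_dependsOn_of_valid (r : LatticeRep G) {b : EuclideanSpace ℝ (Fin 4) → ℝ}
    (hbpos : tsupport b ⊆ {u : EuclideanSpace ℝ (Fin 4) | 0 < u 0}) {s : ℝ} (hs : 0 < s) {q : Fin 4 × Fin 4}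
    (hq : q.1 < q.2) {y : EuclideanSpace ℝ (Fin 4)} (hy : -(s / 2) ≤ y 0) :
    DependsOn (fun U : LGConfig 4 G => ∑' x : Fin 4 → ℤ, b (s • (siteToE x + centreOffset q) - y) * plane G r q x U)
      (siteHalfEdges (d := 4) 0) := by
  intro U V hUV
  refine tsum_congr fun x => ?_
  by_cases hw : b (s • (siteToE x + centreOffset q) - y) = 0
  · simp only [hw, zero_mul]
  · rw [dependsOn_plane r q (base_nonneg_of_weight_ne_zero_of_valid hbpos hs hq hy hw) hUV]

/-- **UV quietness at arbitrary offsets.**  If every valid plaquette of orientation `q` has deficit `∫ (N − P_q(x)) dμ ≤ D` in the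
probability measure `μ`, then for a profile `b` supported in `[0,R₀]⁴`, time-symmetric about `t/2` and bounded by `M_b`, the route's
RP square of the `b`-atom of ANY offset `y` and spacing `s ≥ s₀ > 0` is at most `((⌈R₀/s₀⌉₊+1)⁴ M_b)² · (2 N D)`: the pair series
is a finite double sum over the site boxes of the mirror offset and of the offset (`atomSites`), and each centred two-point weight
is `≤ 2 N D` (`OnsetSkewLawGlue.abs_stateMomentStr_two_le`). [folklore] -/
theorem abs_rpSq_le_of_deficit (r : LatticeRep G) (μ : Measure (LGConfig 4 G)) [IsProbabilityMeasure μ]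
    {b : EuclideanSpace ℝ (Fin 4) → ℝ} {R₀ Mb : ℝ} (t : ℝ) (hR₀ : 0 ≤ R₀)
    (hbR : tsupport b ⊆ {u : EuclideanSpace ℝ (Fin 4) | ∀ j, 0 ≤ u j ∧ u j ≤ R₀})
    (hsym : ∀ u : EuclideanSpace ℝ (Fin 4), b (WithLp.toLp 2 fun i => if i = 0 then t - u i else u i) = b u)
    (hMb : ∀ u, |b u| ≤ Mb) {q : Fin 4 × Fin 4} {D : ℝ}
    (hD : ∀ x : Site 4, ∫ U, ((r.N : ℝ) - plane G r q x U) ∂μ ≤ D)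
    {s₀ s : ℝ} (hs₀ : 0 < s₀) (hs : s₀ ≤ s) (y : EuclideanSpace ℝ (Fin 4)) :
    |∑' pp : ((Fin 4 × Fin 4) × (Fin 4 → ℤ)) × ((Fin 4 × Fin 4) × (Fin 4 → ℤ)),
        (if pp.1.1 ∈ ({q} : Finset (Fin 4 × Fin 4)) ∧ pp.1.1.1 < pp.1.1.2 then
            b (timeReflection 4 (s • (siteToE pp.1.2 + centreOffset pp.1.1)) - y) else 0) *
          (if pp.2.1 ∈ ({q} : Finset (Fin 4 × Fin 4)) ∧ pp.2.1.1 < pp.2.1.2 then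
            b (s • (siteToE pp.2.2 + centreOffset pp.2.1) - y) else 0) *
          stateMomentStr G r μ 2 ![pp.1.1, pp.2.1] ![pp.1.2, pp.2.2]| ≤
      (((⌈R₀ / s₀⌉₊ + 1 : ℕ) : ℝ) ^ 4 * Mb) ^ 2 * (2 * r.N * D) := by
  classical
  haveI : SecondCountableTopology G :=
    (r.continuous.isClosedEmbedding r.injective).isEmbedding.secondCountableTopology
  have hs' : 0 < s := hs₀.trans_le hs
  have hMb0 : 0 ≤ Mb := (abs_nonneg _).trans (hMb 0)
  have hD0 : 0 ≤ D := by
    refine le_trans (integral_nonneg fun U => ?_) (hD 0)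
    have h := Summit.QuantumFields.YangMills.Theorems.OnsetSkewLawGlue.abs_plane_le_N r q 0 U
    simp only [Pi.zero_apply, sub_nonneg]
    exact (abs_le.1 h).2
  -- the mirror weights are the weights of the mirror offset
  have hC0 : 0 ≤ Mb * Mb * (2 * r.N * D) :=
    mul_nonneg (mul_nonneg hMb0 hMb0) (mul_nonneg (mul_nonneg two_pos.le (Nat.cast_nonneg _)) hD0)
  have hwr : ∀ x : Fin 4 → ℤ, b (timeReflection 4 (s • (siteToE x + centreOffset q)) - y) =
      b (s • (siteToE x + centreOffset q) - mirrorOffset t y) := fun x => mirror_weight b t hsym _ _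
  -- the support set
  set S : Finset (((Fin 4 × Fin 4) × (Fin 4 → ℤ)) × ((Fin 4 × Fin 4) × (Fin 4 → ℤ))) :=
    (({q} : Finset (Fin 4 × Fin 4)) ×ˢ atomSites R₀ s (mirrorOffset t y)) ×ˢ
      (({q} : Finset (Fin 4 × Fin 4)) ×ˢ atomSites R₀ s y) with hSdef
  -- termwise bound
  have hterm : ∀ pp : ((Fin 4 × Fin 4) × (Fin 4 → ℤ)) × ((Fin 4 × Fin 4) × (Fin 4 → ℤ)),
      |(if pp.1.1 ∈ ({q} : Finset (Fin 4 × Fin 4)) ∧ pp.1.1.1 < pp.1.1.2 then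
          b (timeReflection 4 (s • (siteToE pp.1.2 + centreOffset pp.1.1)) - y) else 0) *
        (if pp.2.1 ∈ ({q} : Finset (Fin 4 × Fin 4)) ∧ pp.2.1.1 < pp.2.1.2 then
          b (s • (siteToE pp.2.2 + centreOffset pp.2.1) - y) else 0) *
        stateMomentStr G r μ 2 ![pp.1.1, pp.2.1] ![pp.1.2, pp.2.2]| ≤ Mb * Mb * (2 * r.N * D) := by
    intro pp
    by_cases h1 : pp.1.1 ∈ ({q} : Finset (Fin 4 × Fin 4)) ∧ pp.1.1.1 < pp.1.1.2
    · by_cases h2 : pp.2.1 ∈ ({q} : Finset (Fin 4 × Fin 4)) ∧ pp.2.1.1 < pp.2.1.2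
      · have hq1 : pp.1.1 = q := Finset.mem_singleton.1 h1.1
        have hq2 : pp.2.1 = q := Finset.mem_singleton.1 h2.1
        have hD1 : ∫ U, ((r.N : ℝ) - plane G r pp.1.1 pp.1.2 U) ∂μ ≤ D := by rw [hq1]; exact hD pp.1.2
        have hD2 : ∫ U, ((r.N : ℝ) - plane G r pp.2.1 pp.2.2 U) ∂μ ≤ D := by rw [hq2]; exact hD pp.2.2
        have hM := abs_stateMomentStr_two_le r μ pp.1.1 pp.2.1 pp.1.2 pp.2.2 (D := D) hD1 hD2
        rw [if_pos h1, if_pos h2, abs_mul, abs_mul]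
        exact mul_le_mul (mul_le_mul (hMb _) (hMb _) (abs_nonneg _) hMb0) hM (abs_nonneg _) (mul_nonneg hMb0 hMb0)
      · rw [if_neg h2, mul_zero, zero_mul, abs_zero]; exact hC0
    · rw [if_neg h1, zero_mul, zero_mul, abs_zero]; exact hC0
  -- the series is a finite sum over `S`
  rw [tsum_eq_sum (s := S) (fun pp hpp => by
    rw [hSdef, Finset.mem_product, not_and_or] at hpp
    rcases hpp with h | h
    · by_cases h1 : pp.1.1 ∈ ({q} : Finset (Fin 4 × Fin 4)) ∧ pp.1.1.1 < pp.1.1.2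
      · have hq1 : pp.1.1 = q := Finset.mem_singleton.1 h1.1
        have hx : pp.1.2 ∉ atomSites R₀ s (mirrorOffset t y) := fun hx =>
          h (Finset.mem_product.2 ⟨h1.1, hx⟩)
        rw [if_pos h1, hq1, hwr, weight_eq_zero_of_not_mem b hbR hs' q (mirrorOffset t y) hx, zero_mul, zero_mul]
      · rw [if_neg h1, zero_mul, zero_mul]
    · by_cases h2 : pp.2.1 ∈ ({q} : Finset (Fin 4 × Fin 4)) ∧ pp.2.1.1 < pp.2.1.2
      · have hq2 : pp.2.1 = q := Finset.mem_singleton.1 h2.1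
        have hx : pp.2.2 ∉ atomSites R₀ s y := fun hx => h (Finset.mem_product.2 ⟨h2.1, hx⟩)
        rw [if_pos h2, hq2, weight_eq_zero_of_not_mem b hbR hs' q y hx, mul_zero, zero_mul]
      · rw [if_neg h2, mul_zero, zero_mul])]
  -- card of the support set
  have hcardA : ∀ z : EuclideanSpace ℝ (Fin 4), ((atomSites R₀ s z).card : ℝ) ≤ ((⌈R₀ / s₀⌉₊ + 1 : ℕ) : ℝ) ^ 4 := by
    intro z
    have h1 : (atomSites R₀ s z).card = (⌈R₀ / s⌉₊ + 1) ^ 4 := by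
      rw [atomSites, Fintype.card_piFinset]
      have hx : ∀ x : Fin 4, (Finset.Icc ⌊z x / s⌋ (⌊z x / s⌋ + ⌈R₀ / s⌉₊)).card = ⌈R₀ / s⌉₊ + 1 := fun x => by
        rw [Int.card_Icc]; omega
      simp only [hx, Finset.prod_const, Finset.card_univ, Fintype.card_fin]
    have h2 : ⌈R₀ / s⌉₊ ≤ ⌈R₀ / s₀⌉₊ := Nat.ceil_le_ceil (div_le_div_of_nonneg_left hR₀ hs₀ hs)
    rw [h1]
    exact_mod_cast Nat.pow_le_pow_left (by omega) 4
  have hcardS : (S.card : ℝ) ≤ ((⌈R₀ / s₀⌉₊ + 1 : ℕ) : ℝ) ^ 4 * ((⌈R₀ / s₀⌉₊ + 1 : ℕ) : ℝ) ^ 4 := by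
    rw [hSdef, Finset.card_product, Finset.card_product, Finset.card_product, Finset.card_singleton, one_mul, one_mul,
      Nat.cast_mul]
    exact mul_le_mul (hcardA _) (hcardA _) (Nat.cast_nonneg _) (by positivity)
  calc |∑ pp ∈ S, _| ≤ ∑ pp ∈ S, |(if pp.1.1 ∈ ({q} : Finset (Fin 4 × Fin 4)) ∧ pp.1.1.1 < pp.1.1.2 then
            b (timeReflection 4 (s • (siteToE pp.1.2 + centreOffset pp.1.1)) - y) else 0) *
          (if pp.2.1 ∈ ({q} : Finset (Fin 4 × Fin 4)) ∧ pp.2.1.1 < pp.2.1.2 then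
            b (s • (siteToE pp.2.2 + centreOffset pp.2.1) - y) else 0) *
          stateMomentStr G r μ 2 ![pp.1.1, pp.2.1] ![pp.1.2, pp.2.2]| := Finset.abs_sum_le_sum_abs _ _
    _ ≤ ∑ pp ∈ S, Mb * Mb * (2 * r.N * D) := Finset.sum_le_sum fun pp _ => hterm pp
    _ = S.card * (Mb * Mb * (2 * r.N * D)) := by rw [Finset.sum_const, nsmul_eq_mul]
    _ ≤ (((⌈R₀ / s₀⌉₊ + 1 : ℕ) : ℝ) ^ 4 * ((⌈R₀ / s₀⌉₊ + 1 : ℕ) : ℝ) ^ 4) * (Mb * Mb * (2 * r.N * D)) :=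
        mul_le_mul_of_nonneg_right hcardS hC0
    _ = (((⌈R₀ / s₀⌉₊ + 1 : ℕ) : ℝ) ^ 4 * Mb) ^ 2 * (2 * r.N * D) := by ring

end Summit.QuantumFields.YangMills.Theorems.RPOnsetFloorCoarseCollar

end
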